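import Literature.MathematicalPhysics.QuantumFieldTheory.Balaban1983to89.B3LineCut
import Literature.MathematicalPhysics.QuantumFieldTheory.Balaban1983to89.B3Sect3LowestOrderGraphs

/-!
# `Balaban1983to89.B3LineCutDivergentWitnesses` — T. Bałaban, *(Higgs)₂,₃ quantum fields in a finite volume. III.
Renormalization*, Commun. Math. Phys. **88** (1983) 411–445 [Balaban1983Higgs3]: p. 432, *"most of the divergent graphs are
transformed into convergent ones, with the possible exception of graphs with one external vector field leg and vacuum graphs"* —
the EXCEPTIONS and the third outcome (2.4) WITNESSED on the concrete family of graphs `B3Cor23Concrete.Graph`, d = 3 (companion of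
`…B3LineCutDivergent`, which proves the sentence; this file is independent of it and imports only the gen-2/gen-3 carriers)

statement-level skeleton of published theorems with citation tags; proofs where landed; nothing here is a claim about the Yang–Mills mass gap

PDF held: `paper:balaban1983-higgs-2-3-quantum-fields-finite-volume` (journal page = PDF page + 410); p. 432 [PDF 22] read on
the OCR text and the ×2 render `run/shared/lean/pub/pub-balaban/b2b-balaban-ref1/pages/1983-cmp88-higgs23-III/1983-cmp88-higgs23-III-p022-x2.png`.
CITATION HEADER (lean-in-tree rule).  lit-balaban TYPED SKELETON (HOME `run/shared/lean/pub/lit-balaban/`), Phase 2, seat p18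
(gen 6), unit `lit-balaban-p18`: SKELETON row **B3.Eq3.2** (p. 432 reduction paragraph, owner r15, referee ref-4).  p. 432
[PDF 22], verbatim: *"From our analysis in previous chapters it follows that most of the divergent graphs are transformed into
convergent ones, with the possible exception of graphs with one external vector field leg and vacuum graphs."*  Model:
`B3Cor23Concrete` (seat p18 gen 1), `B3LineCut.cutLine` (gen 2: one line replaced by a pair of external legs, another line
remaining), the leg counts of `B3DivergentGraphs`, the picture (3.6) `B3Sect3LowestOrderGraphs.g36a` (gen 3).

WHAT THIS MODULE PROVES (sorry-free; `def`s with bodies = five graphs of the model; no `Prop` fact introduced; every degree by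
kernel computation of the incidence data (2.1) followed by the arithmetic (2.2), d = 3).
(1) THE THIRD OUTCOME OCCURS: the divergent scalar self-energy graph (3.6) (`g36a`, D = −1, two external φ′-legs) with its
(undifferentiated) A′-line replaced by a pair of external legs (`g36aCut`) has four external legs and `D = 0` (`g36aCut_deg`) —
it is the graph (2.4) (p. 424; `B3Graph24Unique.graph24_unique`), neither of positive degree nor one of the printed exceptions.
(2) THE EXCEPTION «VACUUM GRAPHS» IS REAL: `vac3` (two vertices (1.8)_{n=1,n′=0}, both φ′-lines and the A′-line; no external leg;
`D = −2`, `vac3_deg`) cut at its A′-line (`vac3Cut`) is the vector self-energy graph (3.25) with `D = −1` (`vac3Cut_deg`).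
(3) THE EXCEPTION «ONE EXTERNAL VECTOR FIELD LEG» IS REAL: `oneLeg3` (three vertices (1.8)_{1,0}: a φ′-tadpole whose A′-leg is
joined to a φ′-bubble, the bubble's other A′-leg external; `D = −1`, one external leg, `oneLeg3_deg`) cut at its internal A′-line
(`oneLeg3Cut`) has `D = 0` and three external legs (`oneLeg3Cut_deg`) — nonpositive degree and not the graph (2.4).
-/

namespace Literature.MathematicalPhysics.QuantumFieldTheory.Balaban1983to89.B3LineCutDivergentWitnesses

open Finset B3Prop1 B3Sect2Statements B3VertexBridge B3Cor23Concrete B3DivergentGraphs B3LineCut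

variable {nbar : ℕ}

/-! ## The third outcome: (3.6) cut at its A′-line is the graph (2.4) -/

/-- kernel: the A′-line of the graph (3.6) = (3.8) (`B3Sect3LowestOrderGraphs.g36a`: two vertices (1.8)_{1,0}, the φ′-line through
both differentiations, the A′-line). [cite: Balaban1983Higgs3, (3.6) p.435] -/
theorem g36a_vectorLine (hn : 1 ≤ nbar) :
    (B3Sect3LowestOrderGraphs.g36a nbar hn).other ⟨(0 : Fin 2), .inr ⟨0, Nat.one_pos⟩⟩
      = some ⟨(1 : Fin 2), .inr ⟨0, Nat.one_pos⟩⟩ := rfl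

/-- kernel: after the A′-line of (3.6) is replaced by external legs the φ′-line remains. [cite: Balaban1983Higgs3, p.432] -/
theorem g36a_rest (hn : 1 ≤ nbar) :
    ∃ x : Leg (B3Sect3LowestOrderGraphs.g36a nbar hn).kind, (x ≠ ⟨(0 : Fin 2), .inr ⟨0, Nat.one_pos⟩⟩
      ∧ x ≠ ⟨(1 : Fin 2), .inr ⟨0, Nat.one_pos⟩⟩) ∧ ((B3Sect3LowestOrderGraphs.g36a nbar hn).other x).isSome :=
  ⟨⟨(0 : Fin 2), .inl ⟨0, Nat.two_pos⟩⟩, ⟨by simp, by simp⟩, rfl⟩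

/-- The scalar self-energy graph (3.6) (`D = −1` in d = 3, `B3Sect3LowestOrderGraphs.g36a_deg`) with its A′-line replaced by a
pair of external legs. [cite: Balaban1983Higgs3, p.432] -/
def g36aCut (nbar : ℕ) (hn : 1 ≤ nbar) : Graph nbar :=
  cutLine (B3Sect3LowestOrderGraphs.g36a nbar hn) _ _ (g36a_vectorLine hn) (g36a_rest hn)

/-- **The third outcome is realized** (d = 3): the divergent two-leg graph (3.6) cut at its (undifferentiated) A′-line has FOUR
external legs and degree exactly 0 — it is the graph (2.4), neither convergent nor one of the printed exceptions.
[cite: Balaban1983Higgs3, (2.4) p.424] -/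
theorem g36aCut_deg (hn : 1 ≤ nbar) :
    (g36aCut nbar hn).deg 3 = 0 ∧ (g36aCut nbar hn).numExtLegs + numTildeLegs (g36aCut nbar hn) = 4 := by
  have a0 : (g36aCut nbar hn).intScalar (0 : Fin 2) = 1 := by rfl
  have a1 : (g36aCut nbar hn).intScalar (1 : Fin 2) = 1 := by rfl
  have b0 : (g36aCut nbar hn).intVector (0 : Fin 2) = 0 := by rfl
  have b1 : (g36aCut nbar hn).intVector (1 : Fin 2) = 0 := by rfl
  have c0 : (g36aCut nbar hn).intDiffs (0 : Fin 2) = 1 := by rfl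
  have c1 : (g36aCut nbar hn).intDiffs (1 : Fin 2) = 1 := by rfl
  refine ⟨?_, by rfl⟩
  rw [Graph.deg_eq]
  change (∑ i : Fin 2, (g36aCut nbar hn).vertexDeg 3 i) - ((3 : ℕ) : ℚ) = 0
  rw [Fin.sum_univ_two, Graph.vertexDeg_eq, Graph.vertexDeg_eq, a0, a1, b0, b1, c0, c1]
  simp [g36aCut, cutLine, B3LineCut.restrict, B3Sect3LowestOrderGraphs.g36a, VertexKind.etaCount,
    VertexKind.isAveragingVertex]
  norm_num

/-! ## The printed exceptions are real -/

/-- A VACUUM graph of the model: two vertices (1.8)_{n=1,n′=0}, the two φ′-lines (leg 0 to leg 0, leg 1 to leg 1) and the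
A′-line — the vector self-energy graph (3.25) p. 439 with its A′-legs joined; no external leg. [cite: Balaban1983Higgs3, p.432] -/
def vac3 (nbar : ℕ) (hn : 1 ≤ nbar) : Graph nbar where
  nV := 2
  kind _ := .v18 1 0
  adm _ := by simp [VertexKind.Admissible, hn]
  other x := match x with
    | ⟨i, .inl j⟩ => some ⟨i.rev, .inl j⟩
    | ⟨i, .inr j⟩ => some ⟨i.rev, .inr j⟩
  other_ne := by decide
  other_symm := by decide
  other_isLeft := by decide
  exists_line := by decide

/-- kernel: `vac3` is a vacuum graph (no external φ′/A′-leg, no Ã-leg) of degree −2 in d = 3 (each vertex: η³, three internal legs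
−3/2, the differentiation on a line −1: D_G(v) = ½). [cite: Balaban1983Higgs3, (2.2) p.423] -/
theorem vac3_deg (hn : 1 ≤ nbar) :
    (vac3 nbar hn).deg 3 = -2 ∧ (vac3 nbar hn).numExtLegs + numTildeLegs (vac3 nbar hn) = 0 := by
  have a0 : (vac3 nbar hn).intScalar (0 : Fin 2) = 2 := by rfl
  have a1 : (vac3 nbar hn).intScalar (1 : Fin 2) = 2 := by rfl
  have b0 : (vac3 nbar hn).intVector (0 : Fin 2) = 1 := by rfl
  have b1 : (vac3 nbar hn).intVector (1 : Fin 2) = 1 := by rfl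
  have c0 : (vac3 nbar hn).intDiffs (0 : Fin 2) = 1 := by rfl
  have c1 : (vac3 nbar hn).intDiffs (1 : Fin 2) = 1 := by rfl
  refine ⟨?_, by rfl⟩
  rw [Graph.deg_eq]
  change (∑ i : Fin 2, (vac3 nbar hn).vertexDeg 3 i) - ((3 : ℕ) : ℚ) = -2
  rw [Fin.sum_univ_two, Graph.vertexDeg_eq, Graph.vertexDeg_eq, a0, a1, b0, b1, c0, c1]
  simp [vac3, VertexKind.etaCount, VertexKind.isAveragingVertex]
  norm_num

/-- kernel: the A′-line of `vac3`. [cite: Balaban1983Higgs3, p.432] -/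
theorem vac3_vectorLine (hn : 1 ≤ nbar) :
    (vac3 nbar hn).other ⟨(0 : Fin 2), .inr ⟨0, Nat.one_pos⟩⟩ = some ⟨(1 : Fin 2), .inr ⟨0, Nat.one_pos⟩⟩ := rfl

/-- kernel: after the A′-line of `vac3` is replaced by external legs the φ′-lines remain. [cite: Balaban1983Higgs3, p.432] -/
theorem vac3_rest (hn : 1 ≤ nbar) :
    ∃ x : Leg (vac3 nbar hn).kind, (x ≠ ⟨(0 : Fin 2), .inr ⟨0, Nat.one_pos⟩⟩ ∧ x ≠ ⟨(1 : Fin 2), .inr ⟨0, Nat.one_pos⟩⟩)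
      ∧ ((vac3 nbar hn).other x).isSome :=
  ⟨⟨(0 : Fin 2), .inl ⟨0, Nat.two_pos⟩⟩, ⟨by simp, by simp⟩, rfl⟩

/-- `vac3` with its A′-line replaced by a pair of external legs: the vector self-energy graph (3.25) p. 439.
[cite: Balaban1983Higgs3, p.432] -/
def vac3Cut (nbar : ℕ) (hn : 1 ≤ nbar) : Graph nbar :=
  cutLine (vac3 nbar hn) _ _ (vac3_vectorLine hn) (vac3_rest hn)

/-- **The exception «vacuum graphs» is real** (d = 3): cutting the A′-line of the vacuum graph `vac3` (D = −2) gives a graph of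
degree −1 with two external legs — still divergent, and not the graph (2.4). [cite: Balaban1983Higgs3, p.432] -/
theorem vac3Cut_deg (hn : 1 ≤ nbar) :
    (vac3Cut nbar hn).deg 3 = -1 ∧ (vac3Cut nbar hn).numExtLegs + numTildeLegs (vac3Cut nbar hn) = 2 := by
  have a0 : (vac3Cut nbar hn).intScalar (0 : Fin 2) = 2 := by rfl
  have a1 : (vac3Cut nbar hn).intScalar (1 : Fin 2) = 2 := by rfl
  have b0 : (vac3Cut nbar hn).intVector (0 : Fin 2) = 0 := by rfl
  have b1 : (vac3Cut nbar hn).intVector (1 : Fin 2) = 0 := by rfl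
  have c0 : (vac3Cut nbar hn).intDiffs (0 : Fin 2) = 1 := by rfl
  have c1 : (vac3Cut nbar hn).intDiffs (1 : Fin 2) = 1 := by rfl
  refine ⟨?_, by rfl⟩
  rw [Graph.deg_eq]
  change (∑ i : Fin 2, (vac3Cut nbar hn).vertexDeg 3 i) - ((3 : ℕ) : ℚ) = -1
  rw [Fin.sum_univ_two, Graph.vertexDeg_eq, Graph.vertexDeg_eq, a0, a1, b0, b1, c0, c1]
  simp [vac3Cut, cutLine, B3LineCut.restrict, vac3, VertexKind.etaCount, VertexKind.isAveragingVertex]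
  norm_num

/-- A graph with ONE EXTERNAL VECTOR LEG: three vertices (1.8)_{n=1,n′=0}; vertex 0 carries a φ′-tadpole (its two φ′-legs joined)
and its A′-leg is joined to the A′-leg of vertex 1; vertices 1 and 2 are joined by both their φ′-lines (leg 0 to leg 1 and leg 1
to leg 0); the A′-leg of vertex 2 is external (cf. (2.21a)/(2.21d) p. 430 for such tadpole insertions).
[cite: Balaban1983Higgs3, (2.21) p.430] -/
def oneLeg3 (nbar : ℕ) (hn : 1 ≤ nbar) : Graph nbar where
  nV := 3
  kind _ := .v18 1 0
  adm _ := by simp [VertexKind.Admissible, hn]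
  other x := match x with
    | ⟨i, .inl j⟩ =>
      if i.val = 0 then some ⟨i, .inl j.rev⟩
      else if i.val = 1 then some ⟨(2 : Fin 3), .inl j.rev⟩ else some ⟨(1 : Fin 3), .inl j.rev⟩
    | ⟨i, .inr j⟩ =>
      if i.val = 0 then some ⟨(1 : Fin 3), .inr j⟩
      else if i.val = 1 then some ⟨(0 : Fin 3), .inr j⟩ else none
  other_ne := by decide
  other_symm := by decide
  other_isLeft := by decide
  exists_line := by decide

/-- kernel: `oneLeg3` has exactly one external leg, the A′-leg of vertex 2, and degree −1 in d = 3 (D_G = ½, ½, 1).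
[cite: Balaban1983Higgs3, (2.2) p.423] -/
theorem oneLeg3_deg (hn : 1 ≤ nbar) :
    (oneLeg3 nbar hn).deg 3 = -1 ∧ (oneLeg3 nbar hn).numExtLegs + numTildeLegs (oneLeg3 nbar hn) = 1
      ∧ numExtScalarLegs (oneLeg3 nbar hn) = 0 := by
  have a0 : (oneLeg3 nbar hn).intScalar (0 : Fin 3) = 2 := by rfl
  have a1 : (oneLeg3 nbar hn).intScalar (1 : Fin 3) = 2 := by rfl
  have a2 : (oneLeg3 nbar hn).intScalar (2 : Fin 3) = 2 := by rfl
  have b0 : (oneLeg3 nbar hn).intVector (0 : Fin 3) = 1 := by rfl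
  have b1 : (oneLeg3 nbar hn).intVector (1 : Fin 3) = 1 := by rfl
  have b2 : (oneLeg3 nbar hn).intVector (2 : Fin 3) = 0 := by rfl
  have c0 : (oneLeg3 nbar hn).intDiffs (0 : Fin 3) = 1 := by rfl
  have c1 : (oneLeg3 nbar hn).intDiffs (1 : Fin 3) = 1 := by rfl
  have c2 : (oneLeg3 nbar hn).intDiffs (2 : Fin 3) = 1 := by rfl
  refine ⟨?_, by rfl, by rfl⟩
  rw [Graph.deg_eq]
  change (∑ i : Fin 3, (oneLeg3 nbar hn).vertexDeg 3 i) - ((3 : ℕ) : ℚ) = -1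
  rw [Fin.sum_univ_three, Graph.vertexDeg_eq, Graph.vertexDeg_eq, Graph.vertexDeg_eq, a0, a1, a2, b0, b1, b2, c0, c1, c2]
  simp [oneLeg3, VertexKind.etaCount, VertexKind.isAveragingVertex]
  norm_num

/-- kernel: the internal A′-line of `oneLeg3` (vertex 0 to vertex 1). [cite: Balaban1983Higgs3, p.432] -/
theorem oneLeg3_vectorLine (hn : 1 ≤ nbar) :
    (oneLeg3 nbar hn).other ⟨(0 : Fin 3), .inr ⟨0, Nat.one_pos⟩⟩ = some ⟨(1 : Fin 3), .inr ⟨0, Nat.one_pos⟩⟩ := rfl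

/-- kernel: after that A′-line is replaced by external legs the φ′-lines remain. [cite: Balaban1983Higgs3, p.432] -/
theorem oneLeg3_rest (hn : 1 ≤ nbar) :
    ∃ x : Leg (oneLeg3 nbar hn).kind, (x ≠ ⟨(0 : Fin 3), .inr ⟨0, Nat.one_pos⟩⟩ ∧ x ≠ ⟨(1 : Fin 3), .inr ⟨0, Nat.one_pos⟩⟩)
      ∧ ((oneLeg3 nbar hn).other x).isSome :=
  ⟨⟨(0 : Fin 3), .inl ⟨0, Nat.two_pos⟩⟩, ⟨by simp, by simp⟩, rfl⟩

/-- `oneLeg3` with its internal A′-line replaced by a pair of external legs. [cite: Balaban1983Higgs3, p.432] -/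
def oneLeg3Cut (nbar : ℕ) (hn : 1 ≤ nbar) : Graph nbar :=
  cutLine (oneLeg3 nbar hn) _ _ (oneLeg3_vectorLine hn) (oneLeg3_rest hn)

/-- **The exception «graphs with one external vector field leg» is real** (d = 3): cutting the internal A′-line of `oneLeg3`
(D = −1) gives a graph of degree 0 with THREE external legs — nonpositive degree, and not the graph (2.4) (which has four).
[cite: Balaban1983Higgs3, p.432] -/
theorem oneLeg3Cut_deg (hn : 1 ≤ nbar) :
    (oneLeg3Cut nbar hn).deg 3 = 0 ∧ (oneLeg3Cut nbar hn).numExtLegs + numTildeLegs (oneLeg3Cut nbar hn) = 3 := by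
  have a0 : (oneLeg3Cut nbar hn).intScalar (0 : Fin 3) = 2 := by rfl
  have a1 : (oneLeg3Cut nbar hn).intScalar (1 : Fin 3) = 2 := by rfl
  have a2 : (oneLeg3Cut nbar hn).intScalar (2 : Fin 3) = 2 := by rfl
  have b0 : (oneLeg3Cut nbar hn).intVector (0 : Fin 3) = 0 := by rfl
  have b1 : (oneLeg3Cut nbar hn).intVector (1 : Fin 3) = 0 := by rfl
  have b2 : (oneLeg3Cut nbar hn).intVector (2 : Fin 3) = 0 := by rfl
  have c0 : (oneLeg3Cut nbar hn).intDiffs (0 : Fin 3) = 1 := by rfl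
  have c1 : (oneLeg3Cut nbar hn).intDiffs (1 : Fin 3) = 1 := by rfl
  have c2 : (oneLeg3Cut nbar hn).intDiffs (2 : Fin 3) = 1 := by rfl
  refine ⟨?_, by rfl⟩
  rw [Graph.deg_eq]
  change (∑ i : Fin 3, (oneLeg3Cut nbar hn).vertexDeg 3 i) - ((3 : ℕ) : ℚ) = 0
  rw [Fin.sum_univ_three, Graph.vertexDeg_eq, Graph.vertexDeg_eq, Graph.vertexDeg_eq, a0, a1, a2, b0, b1, b2, c0, c1, c2]
  simp [oneLeg3Cut, cutLine, B3LineCut.restrict, oneLeg3, VertexKind.etaCount, VertexKind.isAveragingVertex]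
  norm_num

end Literature.MathematicalPhysics.QuantumFieldTheory.Balaban1983to89.B3LineCutDivergentWitnesses
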